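import Summits.CriticalPhenomena.PercolationContinuityZ3.Theorems.PercNearOneGluingNoHeavyQuantClusterDensity
import HarnessLib

/-!
# QUANT lane (p4 gen 22): the total-variation DEFECT of the cluster law — for `p < p'` there are cluster events `B`
# with `P_p(B) − P_{p'}(B) ≥ θ(p) − ε`

builds on p205010 (kernel theorem, internal audit signed; external expert review pending) — NOT used in this file.

Sequel of `…QuantClusterDensity` (concentration of the axis density `F_N/N` of the infinite clusters at `θ`).  For
`d ≥ 2`, `p < p'` and `θ(p) < m < θ(p')`, the cluster event
`W_{N,m} = {C(0) infinite, #{j < N : je₁ ∈ C(0)} ≤ mN}` has `P_p(W_{N,m}) → θ(p)` and `P_{p'}(W_{N,m}) → 0`: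
on `{|C(0)| = ∞}` the sites `je₁ ∈ C(0)` lie in infinite clusters (so their number is `≤ F_N`), and conversely, by the
almost sure UNIQUENESS of the infinite cluster (Aizenman–Kesten–Newman / Burton–Keane, tree
`Grimmett1999_numInfiniteClusters_le_one_holds`), every `je₁` in an infinite cluster lies in `C(0)` (so their number is
`≥ F_N`); and `F_N/N` concentrates at `θ(p)` resp. `θ(p') > θ(p)` (strict monotonicity of `θ` on `[p_c,1]`,
`ChiF.strictMonoOn_theta_unitInterval`).

* §1 `witness` set `𝒲(N,m)`, measurability, the two inclusions `percolatesAt_inter_subset_witness`,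
  `witness_inter_unique_subset`;
* §2 `theta_le_real_witness_add`, `real_witness_le`;
* §3 **`exists_clusterEvent_sub_ge`** — `∀ ε > 0, ∃ 𝒜: θ(p) − ε ≤ P_p(C ∈ 𝒜) − P_{p'}(C ∈ 𝒜)` (`d ≥ 2`, `p < p'`):
  the laws of the cluster under `P_p` and `P_{p'}` are at total-variation distance at least `θ(p)`; in particular the map
  `p ↦ Law_p(C(0))` is TV-DIScontinuous at every `p` with `θ(p) > 0` (the matching upper bound `θ(p) + o(1)` is
  `ClusterLaw.abs_sub_le_theta_add_chiF` / the volume modulus of `…QuantClusterLawTV`).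

HONEST: elementary (second moment + uniqueness); new as typed; no rate.
-/

noncomputable section

namespace Summit.CriticalPhenomena.PercolationContinuityZ3.Theorems.ClusterLaw

open MeasureTheory Filter Topology Literature.Probability.Percolation Literature.Probability.LatticeModels
open scoped ENNReal Classical

variable {d : ℕ}

/-- `ax[j]`: the site `j·e₁` on the first coordinate axis of `ℤ^d`. -/
local notation3 "ax[" j "]" => (fun i : Fin d => if i.val = 0 then ((j : ℕ) : ℤ) else 0 : Site d)

/-- `cl⁻¹ 𝒜`: the cluster event `{ω | C(0)(ω) ∈ 𝒜}`. -/
local notation3 "cl⁻¹" 𝒜:arg => (fun ω : BondConfig (Site d) => openCluster ω (0 : Site d)) ⁻¹' 𝒜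

/-- `F[N]`: the number of sites among `0, e₁, …, (N−1)e₁` lying in infinite clusters, as a real function. -/
local notation3 "F[" N "]" => fun ω : BondConfig (Site d) =>
  ∑ j ∈ Finset.range N, (percolatesAt (ax[j]) : Set (BondConfig (Site d))).indicator (fun _ => (1 : ℝ)) ω

/-- `𝒲[N, m]`: the infinite vertex sets meeting at most `mN` of the sites `0, e₁, …, (N−1)e₁`. -/
local notation3 "𝒲[" N ", " m "]" => {S : Set (Site d) | S.Infinite ∧
  ∑ j ∈ Finset.range N, S.indicator (fun _ => (1 : ℝ)) (ax[j]) ≤ m * N}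

/-! ### §1 The witness events -/

/-- The count of axis sites in `C(0)` as a sum of connection indicators. -/
theorem sum_indicator_openCluster (N : ℕ) (ω : BondConfig (Site d)) :
    ∑ j ∈ Finset.range N, (openCluster ω (0 : Site d)).indicator (fun _ => (1 : ℝ)) (ax[j]) =
      ∑ j ∈ Finset.range N, (openConn (0 : Site d) (ax[j]) : Set (BondConfig (Site d))).indicator (fun _ => (1 : ℝ)) ω := by
  refine Finset.sum_congr rfl fun j _ => ?_
  by_cases h : (ax[j] : Site d) ∈ openCluster ω (0 : Site d)
  · rw [Set.indicator_of_mem h, Set.indicator_of_mem (show ω ∈ openConn (0 : Site d) (ax[j]) from h)]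
  · rw [Set.indicator_of_notMem h, Set.indicator_of_notMem (show ω ∉ openConn (0 : Site d) (ax[j]) from h)]

/-- The witness event `{C(0) ∈ 𝒲(N,m)}` is measurable. -/
theorem measurableSet_witness (N : ℕ) (m : ℝ) : MeasurableSet (cl⁻¹ 𝒲[N, m]) := by
  have h : (cl⁻¹ 𝒲[N, m]) = (percolatesAt (0 : Site d) : Set (BondConfig (Site d))) ∩
      {ω | ∑ j ∈ Finset.range N, (openConn (0 : Site d) (ax[j]) : Set (BondConfig (Site d))).indicator
        (fun _ => (1 : ℝ)) ω ≤ m * N} := by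
    ext ω
    simp only [Set.mem_preimage, Set.mem_setOf_eq, Set.mem_inter_iff, sum_indicator_openCluster]
    rfl
  rw [h]
  refine (measurableSet_percolatesAt_holds _).inter (measurableSet_le ?_ measurable_const)
  exact Finset.measurable_sum _ fun j _ => measurable_const.indicator (measurableSet_openConn_holds _ _)

/-- **First inclusion**: `{|C(0)| = ∞} ∩ {F_N ≤ mN} ⊆ {C(0) ∈ 𝒲(N,m)}` — an axis site of the infinite `C(0)` lies in an
infinite cluster. -/
theorem percolatesAt_inter_subset_witness (N : ℕ) (m : ℝ) :
    (percolatesAt (0 : Site d) : Set (BondConfig (Site d))) ∩ {ω | F[N] ω ≤ m * N} ⊆ cl⁻¹ 𝒲[N, m] := by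
  rintro ω ⟨h0, hF⟩
  refine ⟨h0, le_trans (Finset.sum_le_sum fun j _ => ?_) hF⟩
  by_cases hj : (ax[j] : Site d) ∈ openCluster ω (0 : Site d)
  · have hinf : ω ∈ percolatesAt (ax[j] : Site d) := by
      -- clusters are classes: `C(je₁) = C(0)` (tree: `openCluster_eq_openCluster_of_mem`, Timár file; inlined)
      have heq : openCluster ω (ax[j] : Site d) = openCluster ω (0 : Site d) := by
        ext z
        exact ⟨fun hz => SimpleGraph.Reachable.trans hj hz, fun hz => SimpleGraph.Reachable.trans hj.symm hz⟩
      change (openCluster ω (ax[j])).Infinite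
      rw [heq]; exact h0
    rw [Set.indicator_of_mem hj, Set.indicator_of_mem hinf]
  · rw [Set.indicator_of_notMem hj]
    exact Set.indicator_nonneg (fun _ _ => zero_le_one) _

/-- **Second inclusion** (uniqueness): `{C(0) ∈ 𝒲(N,m)} ∩ {at most one infinite cluster} ⊆ {F_N ≤ mN}` — an axis site in
an infinite cluster lies in the infinite `C(0)`. -/
theorem witness_inter_unique_subset (N : ℕ) (m : ℝ) :
    (cl⁻¹ 𝒲[N, m]) ∩ {ω | numInfiniteClusters ω ≤ 1} ⊆ {ω | F[N] ω ≤ m * N} := by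
  rintro ω ⟨⟨h0, hle⟩, hN⟩
  refine le_trans (Finset.sum_le_sum fun j _ => ?_) hle
  by_cases hj : ω ∈ percolatesAt (ax[j] : Site d)
  · have hmem : (ax[j] : Site d) ∈ openCluster ω (0 : Site d) := mem_openConn_of_numInfiniteClusters_le_one hN h0 hj
    rw [Set.indicator_of_mem hj, Set.indicator_of_mem hmem]
  · rw [Set.indicator_of_notMem hj]
    exact Set.indicator_nonneg (fun _ _ => zero_le_one) _

/-! ### §2 The probabilities of the witness events -/

/-- **`θ(p) ≤ P_p(C ∈ 𝒲(N,m)) + P_p(|F_N − Nθ(p)| ≥ (m − θ(p))N)`**. -/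
theorem theta_le_real_witness_add (p : unitInterval) (N : ℕ) (m : ℝ) :
    theta (zdGraph d) 0 p ≤ (bondPercolation (zdGraph d) p).real (cl⁻¹ 𝒲[N, m]) +
      (bondPercolation (zdGraph d) p).real
        {ω | (m - theta (zdGraph d) 0 p) * N ≤ |F[N] ω - N * theta (zdGraph d) 0 p|} := by
  set θ := theta (zdGraph d) 0 p with hθ
  have hsub : (percolatesAt (0 : Site d) : Set (BondConfig (Site d))) ⊆
      (cl⁻¹ 𝒲[N, m]) ∪ {ω | (m - θ) * N ≤ |F[N] ω - N * θ|} := by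
    intro ω hω
    by_cases hF : F[N] ω ≤ m * N
    · exact Or.inl (percolatesAt_inter_subset_witness N m ⟨hω, hF⟩)
    · right
      change (m - θ) * N ≤ |F[N] ω - N * θ|
      push Not at hF
      calc (m - θ) * N = m * N - N * θ := by ring
        _ ≤ F[N] ω - N * θ := by linarith
        _ ≤ |F[N] ω - N * θ| := le_abs_self _
  calc θ = (bondPercolation (zdGraph d) p).real (percolatesAt (0 : Site d)) := rfl
    _ ≤ (bondPercolation (zdGraph d) p).real ((cl⁻¹ 𝒲[N, m]) ∪ {ω | (m - θ) * N ≤ |F[N] ω - N * θ|}) :=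
        measureReal_mono hsub (measure_ne_top _ _)
    _ ≤ _ := measureReal_union_le _ _

/-- **`P_q(C ∈ 𝒲(N,m)) ≤ P_q(|F_N − Nθ(q)| ≥ (θ(q) − m)N)`** (a.s. uniqueness at `q`). -/
theorem real_witness_le (q : unitInterval) (N : ℕ) (m : ℝ) :
    (bondPercolation (zdGraph d) q).real (cl⁻¹ 𝒲[N, m]) ≤
      (bondPercolation (zdGraph d) q).real
        {ω | (theta (zdGraph d) 0 q - m) * N ≤ |F[N] ω - N * theta (zdGraph d) 0 q|} := by
  set θ := theta (zdGraph d) 0 q with hθ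
  set μ := bondPercolation (zdGraph d) q with hμ
  have hae : (cl⁻¹ 𝒲[N, m]) ≤ᵐ[μ] {ω | (θ - m) * N ≤ |F[N] ω - N * θ|} := by
    filter_upwards [Grimmett1999_numInfiniteClusters_le_one_holds d q] with ω hN hω
    have hF : F[N] ω ≤ m * N := witness_inter_unique_subset N m ⟨hω, hN⟩
    change (θ - m) * N ≤ |F[N] ω - N * θ|
    calc (θ - m) * N = N * θ - m * N := by ring
      _ ≤ N * θ - F[N] ω := by linarith
      _ ≤ |F[N] ω - N * θ| := by rw [abs_sub_comm]; exact le_abs_self _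
  rw [measureReal_def, measureReal_def]
  exact ENNReal.toReal_mono (measure_ne_top _ _) (measure_mono_ae hae)

/-! ### §3 The total-variation defect -/

/-- **THE TOTAL-VARIATION DEFECT OF THE CLUSTER LAW** (`d ≥ 2`): for `p < p'` and every `ε > 0` there is a cluster event
`B = {C(0) ∈ 𝒜}` with `P_p(B) − P_{p'}(B) ≥ θ(p) − ε`.  Hence `‖Law_p(C) − Law_{p'}(C)‖_TV ≥ θ(p)` for EVERY `p' > p`:
the cluster law is discontinuous in total variation at every `p` with `θ(p) > 0`, with a jump of size at least `θ(p)`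
(and at most `θ(p)`: `ClusterLaw.abs_sub_le_theta_add_chiF`, `…_volume_modulus`). -/
theorem exists_clusterEvent_sub_ge (hd : 2 ≤ d) (p p' : unitInterval) (hpp : p < p') {ε : ℝ} (hε : 0 < ε) :
    ∃ 𝒜 : Set (Set (Site d)), MeasurableSet (cl⁻¹ 𝒜) ∧
      theta (zdGraph d) 0 p - ε ≤ (bondPercolation (zdGraph d) p).real (cl⁻¹ 𝒜) -
        (bondPercolation (zdGraph d) p').real (cl⁻¹ 𝒜) := by
  set θ := theta (zdGraph d) 0 p with hθ
  set θ' := theta (zdGraph d) 0 p' with hθ'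
  have hθ0 : 0 ≤ θ := by rw [hθ]; unfold theta; exact measureReal_nonneg
  rcases hθ0.eq_or_lt with hz | hpos
  · refine ⟨∅, by simp, ?_⟩
    simp only [Set.preimage_empty, measureReal_empty, sub_zero]
    linarith
  · -- `θ(p) < θ(p')` by strict monotonicity on `[p_c, 1]`
    have hpc : criticalProbI d ≤ p := by
      by_contra hlt'
      push Not at hlt'
      have hlt'' : (p : ℝ) < criticalProbI d := hlt'
      rw [coe_criticalProbI] at hlt''
      have := theta_eq_zero_of_lt_criticalProb_holds (zdGraph d) 0 p hlt''
      linarith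
    have hlt : θ < θ' := ChiF.strictMonoOn_theta_unitInterval hd hpc (hpc.trans hpp.le) hpp
    set m := (θ + θ') / 2 with hm
    set δ := (θ' - θ) / 2 with hδ
    have hδ0 : 0 < δ := by rw [hδ]; linarith
    have hd1 : 1 ≤ d := by omega
    have hε2 : 0 < ε / 2 := by linarith
    obtain ⟨N, hN1, hN2⟩ := ((eventually_real_abs_density_sub_theta_ge_le hd1 p hδ0 hε2).and
      (eventually_real_abs_density_sub_theta_ge_le hd1 p' hδ0 hε2)).exists
    refine ⟨𝒲[N, m], measurableSet_witness N m, ?_⟩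
    have h1 := theta_le_real_witness_add (d := d) p N m
    have h2 := real_witness_le (d := d) p' N m
    have e1 : m - θ = δ := by rw [hm, hδ]; ring
    have e2 : θ' - m = δ := by rw [hm, hδ]; ring
    rw [← hθ, e1] at h1
    rw [← hθ', e2] at h2
    linarith

end Summit.CriticalPhenomena.PercolationContinuityZ3.Theorems.ClusterLaw
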